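import Literature.Analysis.FluidPDE.KNSSSwirlSupNonpos
import Literature.Analysis.FluidPDE.AxisymWeights
import Literature.Analysis.FluidPDE.RadialCalculus
import Literature.Analysis.FluidPDE.MildSolutionProofs
import Literature.Analysis.FluidPDE.HessianLaplacian
import HarnessLib

/-!
# Lei–Ren–Zhang 2019, Theorem 1.2: the weights of the energy method and their calculus

Analysis/FluidPDE proof file (no definitions, no named facts, no `sorry`) on the discharge path of
the named fact `Literature.Analysis.FluidPDE.leiRenZhang2019_liouville_swirl_rate` (Z. Lei,
X. Ren, Q. S. Zhang, arXiv:1902.11229, Theorem 1.2, proof in §4, pp. 10–12).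

The printed proof performs the energy estimate for `Γ = r v_θ` "against the measure
`λ(r) dr dz` with carefully chosen cut-off functions", `λ(r) = r` for `r ≤ r₀`, decreasing to a
constant beyond (4.3), so as "to take the advantage of both the three dimensional behavior of the
system near the axis and the two dimensional nature away from the axis". In Cartesian variables
on `ℝ³` (`dx = r dr dθ dz`) this is the weight `λ(r)/r`: equal to `1` near the axis and decaying
in `r`. This file provides the two weights used by the tree's rendering of the argument
(`LeiRenZhangSwirlRate`), written out explicitly in every statement (no definitions are
introduced, as in `AxisymWeights`):

* the **radial weight** `w_{r₀}(x) = r₀² / (r₀² + x₀² + x₁²)` (a smooth substitute for `λ(r)/r`,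
  `= 1` on the axis, `∼ r₀²/r²` at infinity): smoothness, axisymmetry, `0 < w ≤ 1`, its gradient
  `Dw(x)h = −(2r₀²/(r₀² + r²)²)(x₀h₀ + x₁h₁)` and its Laplacian
  `Δw(x) = 4r₀²(r² − r₀²)/(r₀² + r²)³`, with the bounds `|Dw(x)h| ≤ (2r₀²r/(r₀²+r²)²)‖h‖`,
  `|Δw| ≤ 4r₀²/(r₀²+r²)²`, and the radial factorisation `x₀h₀ + x₁h₁ = r ⟪e_r, h⟫`;
* the **ball cut-off** `χ_R(x) = smoothTransition(2 − |x|²/R²)²` of `AxisymWeights` at scale `R`: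
  axisymmetry, the scaling law `χ_R(x) = χ₁(R⁻¹x)` and the bounds `‖Dχ_R‖ ≤ B₁/R`,
  `|Δχ_R| ≤ B₂/R²` with absolute constants (the second by scaling, `laplacian_comp_smul`, and
  compactness at scale one), its support inside `{|x| ≤ 2R} ⊆ {r ≤ 2R, |x₂| ≤ 2R}` and its value
  `1` on `{|x| ≤ R}`.

## References

* Z. Lei, X. Ren, Q. S. Zhang, arXiv:1902.11229, §4, (4.3) and Step 2 (the weight `λ` and the
  cut-offs), pp. 10–11. [LeiRenZhang2019]
-/

noncomputable section

open MeasureTheory Set Function Filter Topology TopologicalSpace InnerProductSpace WithLp Metric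
open scoped Laplacian RealInnerProductSpace ContDiff

namespace Literature.Analysis.FluidPDE

/-! ### The radial weight `w_{r₀}(x) = r₀² / (r₀² + x₀² + x₁²)` -/

section RadialWeight

/-- The denominator of the radial weight is positive. [folklore] -/
theorem radialWeight_den_pos {r₀ : ℝ} (hr₀ : 0 < r₀) (x : EuclideanSpace ℝ (Fin 3)) :
    0 < r₀ ^ 2 + (x 0 ^ 2 + x 1 ^ 2) := by positivity

/-- The denominator of the radial weight in terms of the cylindrical radius:
`r₀² + x₀² + x₁² = r₀² + r²`. [folklore] -/
theorem radialWeight_den_eq {r₀ : ℝ} (x : EuclideanSpace ℝ (Fin 3)) :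
    r₀ ^ 2 + (x 0 ^ 2 + x 1 ^ 2) = r₀ ^ 2 + cylRadius x ^ 2 := by
  rw [cylRadius_sq]

/-- **The radial weight is smooth** (a quotient with positive denominator). [folklore] -/
theorem contDiff_radialWeight {r₀ : ℝ} (hr₀ : 0 < r₀) {n : WithTop ℕ∞} :
    ContDiff ℝ n fun x : EuclideanSpace ℝ (Fin 3) => r₀ ^ 2 / (r₀ ^ 2 + (x 0 ^ 2 + x 1 ^ 2)) :=
  contDiff_const.div (contDiff_const.add contDiff_sq_add_sq) fun x => (radialWeight_den_pos hr₀ x).ne'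

/-- **The radial weight is an axisymmetric scalar** (it is a function of `r`). [folklore] -/
theorem isAxisymmetricScalar_radialWeight (r₀ : ℝ) :
    IsAxisymmetricScalar fun x : EuclideanSpace ℝ (Fin 3) => r₀ ^ 2 / (r₀ ^ 2 + (x 0 ^ 2 + x 1 ^ 2)) := by
  intro θ x
  simp only [radialWeight_den_eq, cylRadius_rotZ]

/-- `0 < w_{r₀} ≤ 1`. [folklore] -/
theorem radialWeight_pos_le_one {r₀ : ℝ} (hr₀ : 0 < r₀) (x : EuclideanSpace ℝ (Fin 3)) :
    0 < r₀ ^ 2 / (r₀ ^ 2 + (x 0 ^ 2 + x 1 ^ 2)) ∧ r₀ ^ 2 / (r₀ ^ 2 + (x 0 ^ 2 + x 1 ^ 2)) ≤ 1 := by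
  have hd := radialWeight_den_pos hr₀ x
  refine ⟨div_pos (by positivity) hd, ?_⟩
  rw [div_le_one hd]
  nlinarith [sq_nonneg (x 0), sq_nonneg (x 1)]

/-- `w_{r₀} = 1` on the axis. [folklore] -/
theorem radialWeight_eq_one_of_cylRadius_eq_zero {r₀ : ℝ} (hr₀ : 0 < r₀) {x : EuclideanSpace ℝ (Fin 3)}
    (hx : cylRadius x = 0) : r₀ ^ 2 / (r₀ ^ 2 + (x 0 ^ 2 + x 1 ^ 2)) = 1 := by
  obtain ⟨h0, h1⟩ := (cylRadius_eq_zero_iff x).1 hx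
  rw [h0, h1]
  have : (r₀ ^ 2 : ℝ) ≠ 0 := by positivity
  field_simp
  ring

/-- The radial weight as a function of the cylindrical radius: `w = r₀²/(r₀² + r²)`, and the
comparison `w ≤ 1`, `w ≤ r₀²/r²`-type bound `r² w ≤ r₀²`. [folklore] -/
theorem radialWeight_eq_profile {r₀ : ℝ} (x : EuclideanSpace ℝ (Fin 3)) :
    r₀ ^ 2 / (r₀ ^ 2 + (x 0 ^ 2 + x 1 ^ 2)) = r₀ ^ 2 / (r₀ ^ 2 + cylRadius x ^ 2) := by
  rw [radialWeight_den_eq]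

/-- **The derivative of the radial weight**:
`Dw(x) h = −(2 r₀² / (r₀² + x₀² + x₁²)²) (x₀ h₀ + x₁ h₁)`. [folklore] -/
theorem hasFDerivAt_radialWeight {r₀ : ℝ} (hr₀ : 0 < r₀) (x : EuclideanSpace ℝ (Fin 3)) :
    HasFDerivAt (fun y : EuclideanSpace ℝ (Fin 3) => r₀ ^ 2 / (r₀ ^ 2 + (y 0 ^ 2 + y 1 ^ 2)))
      ((-(2 * r₀ ^ 2 / (r₀ ^ 2 + (x 0 ^ 2 + x 1 ^ 2)) ^ 2)) •
        ((x 0) • (EuclideanSpace.proj (0 : Fin 3) : EuclideanSpace ℝ (Fin 3) →L[ℝ] ℝ) +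
          (x 1) • (EuclideanSpace.proj (1 : Fin 3) : EuclideanSpace ℝ (Fin 3) →L[ℝ] ℝ))) x := by
  set P0 := (EuclideanSpace.proj (0 : Fin 3) : EuclideanSpace ℝ (Fin 3) →L[ℝ] ℝ) with hP0
  set P1 := (EuclideanSpace.proj (1 : Fin 3) : EuclideanSpace ℝ (Fin 3) →L[ℝ] ℝ) with hP1
  -- the denominator `q(y) = r₀² + y₀² + y₁²`
  have hq : HasFDerivAt (fun y : EuclideanSpace ℝ (Fin 3) => r₀ ^ 2 + (y 0 ^ 2 + y 1 ^ 2))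
      ((2 * x 0) • P0 + (2 * x 1) • P1) x := by
    have h0 : HasFDerivAt (fun y : EuclideanSpace ℝ (Fin 3) => y 0 ^ 2) ((2 * x 0) • P0) x := by
      have := (P0.hasFDerivAt (x := x)).pow 2
      simpa [hP0, pow_one] using this
    have h1 : HasFDerivAt (fun y : EuclideanSpace ℝ (Fin 3) => y 1 ^ 2) ((2 * x 1) • P1) x := by
      have := (P1.hasFDerivAt (x := x)).pow 2
      simpa [hP1, pow_one] using this
    exact (h0.add h1).const_add (r₀ ^ 2)
  have hne : r₀ ^ 2 + (x 0 ^ 2 + x 1 ^ 2) ≠ 0 := (radialWeight_den_pos hr₀ x).ne'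
  have hinv := ((hasDerivAt_inv hne).comp_hasFDerivAt x hq).const_mul (r₀ ^ 2)
  have heq : (fun y : EuclideanSpace ℝ (Fin 3) => r₀ ^ 2 / (r₀ ^ 2 + (y 0 ^ 2 + y 1 ^ 2))) =
      fun y => r₀ ^ 2 * ((fun t : ℝ => t⁻¹) ∘ fun y : EuclideanSpace ℝ (Fin 3) => r₀ ^ 2 + (y 0 ^ 2 + y 1 ^ 2)) y := by
    funext y; simp [div_eq_mul_inv]
  rw [heq]
  refine hinv.congr_fderiv ?_
  ext h
  simp [hP0, hP1]
  field_simp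

/-- **The derivative of the radial weight, applied**:
`Dw(x) h = −(2 r₀² / (r₀² + x₀² + x₁²)²) (x₀ h₀ + x₁ h₁)`. [folklore] -/
theorem fderiv_radialWeight_apply {r₀ : ℝ} (hr₀ : 0 < r₀) (x h : EuclideanSpace ℝ (Fin 3)) :
    fderiv ℝ (fun y : EuclideanSpace ℝ (Fin 3) => r₀ ^ 2 / (r₀ ^ 2 + (y 0 ^ 2 + y 1 ^ 2))) x h =
      -(2 * r₀ ^ 2 / (r₀ ^ 2 + (x 0 ^ 2 + x 1 ^ 2)) ^ 2) * (x 0 * h 0 + x 1 * h 1) := by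
  rw [(hasFDerivAt_radialWeight hr₀ x).fderiv]
  simp
  ring

/-- The radial component of a vector: `⟪e_r(x), h⟫ = (x₀ h₀ + x₁ h₁) / r` (both sides vanish on
the axis, where `e_r = 0` by its junk value). [folklore] -/
theorem inner_eR_left_eq (x h : EuclideanSpace ℝ (Fin 3)) :
    ⟪eR x, h⟫ = (cylRadius x)⁻¹ * (x 0 * h 0 + x 1 * h 1) := by
  simp only [eR, PiLp.inner_apply, RCLike.inner_apply, conj_trivial, Fin.sum_univ_three]
  simp
  ring

/-- **The horizontal pairing is radial**: `x₀ h₀ + x₁ h₁ = r ⟪e_r(x), h⟫` (both sides vanish on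
the axis). [folklore] -/
theorem horizontal_inner_eq_cylRadius_mul_inner_eR (x h : EuclideanSpace ℝ (Fin 3)) :
    x 0 * h 0 + x 1 * h 1 = cylRadius x * ⟪eR x, h⟫ := by
  rw [inner_eR_left_eq]
  by_cases hx : cylRadius x = 0
  · obtain ⟨h0, h1⟩ := (cylRadius_eq_zero_iff x).1 hx
    rw [h0, h1, hx]; ring
  · field_simp

/-- **Size of the derivative of the radial weight**:
`|Dw(x) h| ≤ (2 r₀² r / (r₀² + r²)²) |⟪e_r(x), h⟫|`, with equality of absolute values. [folklore] -/
theorem abs_fderiv_radialWeight_apply_eq {r₀ : ℝ} (hr₀ : 0 < r₀) (x h : EuclideanSpace ℝ (Fin 3)) :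
    |fderiv ℝ (fun y : EuclideanSpace ℝ (Fin 3) => r₀ ^ 2 / (r₀ ^ 2 + (y 0 ^ 2 + y 1 ^ 2))) x h| =
      2 * r₀ ^ 2 * cylRadius x / (r₀ ^ 2 + cylRadius x ^ 2) ^ 2 * |⟪eR x, h⟫| := by
  rw [fderiv_radialWeight_apply hr₀, horizontal_inner_eq_cylRadius_mul_inner_eR, radialWeight_den_eq,
    abs_mul, abs_neg, abs_mul, abs_of_nonneg (cylRadius_nonneg x),
    abs_of_nonneg (by positivity : (0 : ℝ) ≤ 2 * r₀ ^ 2 / (r₀ ^ 2 + cylRadius x ^ 2) ^ 2)]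
  ring

/-- `|Dw(x) h| ≤ (2 r₀² r / (r₀² + r²)²) ‖h‖` (since `|⟪e_r, h⟫| ≤ ‖h‖`). [folklore] -/
theorem abs_fderiv_radialWeight_apply_le {r₀ : ℝ} (hr₀ : 0 < r₀) (x h : EuclideanSpace ℝ (Fin 3)) :
    |fderiv ℝ (fun y : EuclideanSpace ℝ (Fin 3) => r₀ ^ 2 / (r₀ ^ 2 + (y 0 ^ 2 + y 1 ^ 2))) x h| ≤
      2 * r₀ ^ 2 * cylRadius x / (r₀ ^ 2 + cylRadius x ^ 2) ^ 2 * ‖h‖ := by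
  rw [abs_fderiv_radialWeight_apply_eq hr₀]
  have hr := cylRadius_nonneg x
  refine mul_le_mul_of_nonneg_left ?_ (by positivity)
  exact (abs_real_inner_le_norm _ _).trans (mul_le_of_le_one_left (norm_nonneg _) (norm_eR_le_one _))

end RadialWeight

/-! ### The Laplacian of the radial weight -/

section RadialWeightLaplacian

/-- **The Laplacian commutes with the horizontal projection**: `Δ(g ∘ P)(x) = (Δg)(Px)` for `C²`
maps `g` on the horizontal plane and `P x = (x₀, x₁)` (`Σᵢ D²g(Px)[Peᵢ, Peᵢ]` runs over
`Pe₀ = e₀'`, `Pe₁ = e₁'`, `Pe₂ = 0`; cf. `laplacian_comp_planarProj`). [folklore] -/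
theorem laplacian_comp_horizProj {P : EuclideanSpace ℝ (Fin 3) →L[ℝ] EuclideanSpace ℝ (Fin 2)}
    (hP : ∀ v : EuclideanSpace ℝ (Fin 3), P v = toLp 2 ![v 0, v 1])
    {F : Type*} [NormedAddCommGroup F] [NormedSpace ℝ F]
    {g : EuclideanSpace ℝ (Fin 2) → F} (hg : ContDiff ℝ 2 g) (x : EuclideanSpace ℝ (Fin 3)) :
    Δ (fun x => g (P x)) x = Δ g (P x) := by
  have hPe : ∀ i : Fin 3, P (EuclideanSpace.single i (1 : ℝ)) =
      if i = 0 then EuclideanSpace.single 0 (1 : ℝ) else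
        if i = 1 then EuclideanSpace.single 1 (1 : ℝ) else 0 := fun i => by
    rw [hP]; ext j; fin_cases i <;> fin_cases j <;> simp
  rw [laplacian_eq_iteratedFDeriv_orthonormalBasis _ (EuclideanSpace.basisFun (Fin 3) ℝ),
    laplacian_eq_iteratedFDeriv_orthonormalBasis _ (EuclideanSpace.basisFun (Fin 2) ℝ)]
  have hcomp : (fun x => g (P x)) = g ∘ P := rfl
  simp only [hcomp, P.iteratedFDeriv_comp_right hg x (i := 2) le_rfl,
    ContinuousMultilinearMap.compContinuousLinearMap_apply, EuclideanSpace.basisFun_apply,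
    Fin.sum_univ_three, Fin.sum_univ_two]
  have hv : ∀ i : Fin 3, (fun k : Fin 2 => P ((![EuclideanSpace.single i (1 : ℝ),
      EuclideanSpace.single i (1 : ℝ)] : Fin 2 → EuclideanSpace ℝ (Fin 3)) k)) =
      ![P (EuclideanSpace.single i (1 : ℝ)), P (EuclideanSpace.single i (1 : ℝ))] := fun i => by
    funext k; fin_cases k <;> rfl
  simp only [hv, hPe]
  simp only [Fin.isValue, ↓reduceIte, Fin.reduceEq]
  rw [(iteratedFDeriv ℝ 2 g (P x)).map_coord_zero (m := ![(0 : EuclideanSpace ℝ (Fin 2)), 0]) 0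
    rfl, add_zero]

/-- The horizontal projection `P x = (x₀, x₁)` has `‖P x‖² = x₀² + x₁²`. [folklore] -/
theorem norm_sq_horizProj {P : EuclideanSpace ℝ (Fin 3) →L[ℝ] EuclideanSpace ℝ (Fin 2)}
    (hP : ∀ v : EuclideanSpace ℝ (Fin 3), P v = toLp 2 ![v 0, v 1]) (x : EuclideanSpace ℝ (Fin 3)) :
    ‖P x‖ ^ 2 = x 0 ^ 2 + x 1 ^ 2 := by
  rw [hP, EuclideanSpace.norm_sq_eq, Fin.sum_univ_two]
  simp [Real.norm_eq_abs, sq_abs]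

/-- A horizontal projection `P x = (x₀, x₁)` exists as a continuous linear map. [folklore] -/
theorem exists_horizProj : ∃ P : EuclideanSpace ℝ (Fin 3) →L[ℝ] EuclideanSpace ℝ (Fin 2),
    ∀ v : EuclideanSpace ℝ (Fin 3), P v = toLp 2 ![v 0, v 1] := by
  refine ⟨(EuclideanSpace.proj (0 : Fin 3)).smulRight (EuclideanSpace.single (0 : Fin 2) (1 : ℝ)) +
      (EuclideanSpace.proj (1 : Fin 3)).smulRight (EuclideanSpace.single (1 : Fin 2) (1 : ℝ)), fun v => ?_⟩
  ext j; fin_cases j <;> simp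

/-- The one-variable profile of the radial weight in the variable `s = r²`, `g(s) = r₀²/(r₀² + s)`,
has derivative `g'(s) = −r₀²/(r₀² + s)²` for `s > −r₀²`. [folklore] -/
theorem hasDerivAt_radialProfile {r₀ s : ℝ} (hs : 0 < r₀ ^ 2 + s) :
    HasDerivAt (fun s : ℝ => r₀ ^ 2 / (r₀ ^ 2 + s)) (-(r₀ ^ 2 / (r₀ ^ 2 + s) ^ 2)) s := by
  have hd : HasDerivAt (fun s : ℝ => r₀ ^ 2 + s) 1 s := (hasDerivAt_id s).const_add _
  have h := (hasDerivAt_const s (r₀ ^ 2)).div hd hs.ne'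
  refine h.congr_deriv ?_
  field_simp
  ring

/-- The derivative profile `g₁(s) = −r₀²/(r₀² + s)²` has derivative `2r₀²/(r₀² + s)³`. [folklore] -/
theorem hasDerivAt_radialProfile_deriv {r₀ s : ℝ} (hs : 0 < r₀ ^ 2 + s) :
    HasDerivAt (fun s : ℝ => -(r₀ ^ 2 / (r₀ ^ 2 + s) ^ 2)) (2 * r₀ ^ 2 / (r₀ ^ 2 + s) ^ 3) s := by
  have hd : HasDerivAt (fun s : ℝ => (r₀ ^ 2 + s) ^ 2) (2 * (r₀ ^ 2 + s)) s := by
    have := ((hasDerivAt_id s).const_add (r₀ ^ 2)).fun_pow 2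
    refine this.congr_deriv ?_
    simp
  have h := ((hasDerivAt_const s (r₀ ^ 2)).div hd (by positivity)).neg
  refine h.congr_deriv ?_
  have hne : r₀ ^ 2 + s ≠ 0 := hs.ne'
  field_simp
  ring

/-- **The Laplacian of the radial weight**:
`Δw(x) = 4 r₀² (x₀² + x₁² − r₀²) / (r₀² + x₀² + x₁²)³` (the planar radial formula
`Δ(g(|y|²)) = 4g''|y|² + 4g'` transported by the horizontal projection). [folklore] -/
theorem laplacian_radialWeight {r₀ : ℝ} (hr₀ : 0 < r₀) (x : EuclideanSpace ℝ (Fin 3)) :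
    Δ (fun y : EuclideanSpace ℝ (Fin 3) => r₀ ^ 2 / (r₀ ^ 2 + (y 0 ^ 2 + y 1 ^ 2))) x =
      4 * r₀ ^ 2 * ((x 0 ^ 2 + x 1 ^ 2) - r₀ ^ 2) / (r₀ ^ 2 + (x 0 ^ 2 + x 1 ^ 2)) ^ 3 := by
  obtain ⟨P, hP⟩ := exists_horizProj
  set g : ℝ → ℝ := fun s => r₀ ^ 2 / (r₀ ^ 2 + s) with hg
  set g₁ : ℝ → ℝ := fun s => -(r₀ ^ 2 / (r₀ ^ 2 + s) ^ 2) with hg₁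
  have hfun : (fun y : EuclideanSpace ℝ (Fin 3) => r₀ ^ 2 / (r₀ ^ 2 + (y 0 ^ 2 + y 1 ^ 2))) =
      fun y => (fun z : EuclideanSpace ℝ (Fin 2) => g (‖z‖ ^ 2)) (P y) := by
    funext y
    simp only [hg, norm_sq_horizProj hP]
  -- smoothness of the planar radial function
  set U : Set ℝ := Ioi (-r₀ ^ 2) with hU
  have hUo : IsOpen U := isOpen_Ioi
  have hUpos : ∀ s ∈ U, 0 < r₀ ^ 2 + s := fun s hs => by
    have : -r₀ ^ 2 < s := hs
    linarith
  have hgd : ∀ s ∈ U, HasDerivAt g (g₁ s) s := fun s hs => hasDerivAt_radialProfile (hUpos s hs)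
  have hg2 : ContDiff ℝ 2 fun z : EuclideanSpace ℝ (Fin 2) => g (‖z‖ ^ 2) := by
    have h1 : ContDiff ℝ 2 fun z : EuclideanSpace ℝ (Fin 2) => r₀ ^ 2 + ‖z‖ ^ 2 :=
      contDiff_const.add (contDiff_norm_sq ℝ)
    exact contDiff_const.div h1 fun z => by positivity
  rw [hfun, laplacian_comp_horizProj hP hg2]
  have hz : ‖P x‖ ^ 2 ∈ U := by
    show -r₀ ^ 2 < ‖P x‖ ^ 2
    have := sq_nonneg ‖P x‖
    have : 0 < r₀ ^ 2 := by positivity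
    linarith
  have hg₁d : HasDerivAt g₁ (2 * r₀ ^ 2 / (r₀ ^ 2 + ‖P x‖ ^ 2) ^ 3) (‖P x‖ ^ 2) :=
    hasDerivAt_radialProfile_deriv (hUpos _ hz)
  rw [laplacian_comp_norm_sq hUo hgd hz hg₁d, finrank_euclideanSpace, Fintype.card_fin, norm_sq_horizProj hP]
  simp only [hg₁]
  have hne : r₀ ^ 2 + (x 0 ^ 2 + x 1 ^ 2) ≠ 0 := (radialWeight_den_pos hr₀ x).ne'
  push_cast
  field_simp
  ring

/-- **Size of the Laplacian of the radial weight**: `|Δw(x)| ≤ 4 r₀² / (r₀² + r²)²`. [folklore] -/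
theorem abs_laplacian_radialWeight_le {r₀ : ℝ} (hr₀ : 0 < r₀) (x : EuclideanSpace ℝ (Fin 3)) :
    |Δ (fun y : EuclideanSpace ℝ (Fin 3) => r₀ ^ 2 / (r₀ ^ 2 + (y 0 ^ 2 + y 1 ^ 2))) x| ≤
      4 * r₀ ^ 2 / (r₀ ^ 2 + cylRadius x ^ 2) ^ 2 := by
  rw [laplacian_radialWeight hr₀, radialWeight_den_eq]
  set q : ℝ := cylRadius x ^ 2 with hq
  have hq0 : 0 ≤ q := sq_nonneg _
  have hd : 0 < r₀ ^ 2 + q := by positivity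
  rw [show x 0 ^ 2 + x 1 ^ 2 = q by rw [hq, cylRadius_sq], abs_div, abs_of_pos (pow_pos hd 3),
    div_le_div_iff₀ (pow_pos hd 3) (pow_pos hd 2)]
  have h1 : |4 * r₀ ^ 2 * (q - r₀ ^ 2)| ≤ 4 * r₀ ^ 2 * (r₀ ^ 2 + q) := by
    rw [abs_mul, abs_of_pos (by positivity : (0 : ℝ) < 4 * r₀ ^ 2)]
    refine mul_le_mul_of_nonneg_left (abs_le.2 ⟨by nlinarith, by nlinarith⟩) (by positivity)
  calc |4 * r₀ ^ 2 * (q - r₀ ^ 2)| * (r₀ ^ 2 + q) ^ 2 ≤ 4 * r₀ ^ 2 * (r₀ ^ 2 + q) * (r₀ ^ 2 + q) ^ 2 :=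
        mul_le_mul_of_nonneg_right h1 (by positivity)
    _ = 4 * r₀ ^ 2 * (r₀ ^ 2 + q) ^ 3 := by ring

end RadialWeightLaplacian

/-! ### The ball cut-off `χ_R(x) = smoothTransition(2 − |x|²/R²)²` at scale `R` -/

section BallCutoff

/-- The ball cut-off is an axisymmetric scalar (it is radial). [folklore] -/
theorem isAxisymmetricScalar_sqBallCutoff (R : ℝ) :
    IsAxisymmetricScalar fun x : EuclideanSpace ℝ (Fin 3) =>
      Real.smoothTransition (2 - ‖x‖ ^ 2 / R ^ 2) ^ 2 := by
  intro θ x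
  simp only [norm_rotZ]

/-- **Scaling law**: `χ_R(x) = χ₁(R⁻¹ x)`. [folklore] -/
theorem sqBallCutoff_eq_comp_smul (R : ℝ) (x : EuclideanSpace ℝ (Fin 3)) :
    Real.smoothTransition (2 - ‖x‖ ^ 2 / R ^ 2) ^ 2 =
      Real.smoothTransition (2 - ‖R⁻¹ • x‖ ^ 2 / 1 ^ 2) ^ 2 := by
  rw [norm_smul, norm_inv, Real.norm_eq_abs, mul_pow, inv_pow, sq_abs, one_pow, div_one,
    div_eq_inv_mul]

/-- **A uniform bound for the Laplacian of the ball cut-off**: there is an absolute constant `B₂`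
with `|Δχ_R(x)| ≤ B₂ / R²` for all `R > 0` (by the scaling law, `laplacian_comp_smul`, and the
boundedness of `Δχ₁`, a continuous compactly supported function). [folklore] -/
theorem exists_bound_laplacian_sqBallCutoff : ∃ B₂ : ℝ, 0 ≤ B₂ ∧ ∀ R : ℝ, 0 < R →
    ∀ x : EuclideanSpace ℝ (Fin 3),
      |Δ (fun y : EuclideanSpace ℝ (Fin 3) => Real.smoothTransition (2 - ‖y‖ ^ 2 / R ^ 2) ^ 2) x| ≤
        B₂ / R ^ 2 := by
  have h1 : ContDiff ℝ 2 fun y : EuclideanSpace ℝ (Fin 3) => Real.smoothTransition (2 - ‖y‖ ^ 2 / 1 ^ 2) ^ 2 :=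
    contDiff_sqBallCutoff 1
  obtain ⟨B, hB⟩ := (continuous_laplacian h1).bounded_above_of_compact_support
    (HasCompactSupport.laplacian_fun (hasCompactSupport_sqBallCutoff one_pos))
  refine ⟨max B 0, le_max_right _ _, fun R hR x => ?_⟩
  have hfun : (fun y : EuclideanSpace ℝ (Fin 3) => Real.smoothTransition (2 - ‖y‖ ^ 2 / R ^ 2) ^ 2) =
      fun y => (fun z : EuclideanSpace ℝ (Fin 3) => Real.smoothTransition (2 - ‖z‖ ^ 2 / 1 ^ 2) ^ 2) (R⁻¹ • y) :=
    funext fun y => sqBallCutoff_eq_comp_smul R y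
  rw [hfun, laplacian_comp_smul h1 R⁻¹ x, smul_eq_mul, abs_mul, inv_pow, abs_of_pos (by positivity),
    div_eq_inv_mul]
  refine mul_le_mul_of_nonneg_left ?_ (by positivity)
  have h := hB (R⁻¹ • x)
  rw [Real.norm_eq_abs] at h
  exact h.trans (le_max_left _ _)

/-- **A uniform bound for the gradient of the ball cut-off**: `‖Dχ_R(x)‖ ≤ B₁ / R` with the
absolute constant `B₁ = 4√2 C_S` (`norm_fderiv_sqBallCutoff_le'`). [folklore] -/
theorem norm_fderiv_sqBallCutoff_le_const {R : ℝ} (hR : 0 < R) (x : EuclideanSpace ℝ (Fin 3)) :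
    ‖fderiv ℝ (fun y : EuclideanSpace ℝ (Fin 3) => Real.smoothTransition (2 - ‖y‖ ^ 2 / R ^ 2) ^ 2) x‖ ≤
      4 * Real.sqrt 2 * smoothTransitionC2Bound / R :=
  norm_fderiv_sqBallCutoff_le' abs_deriv_smoothTransition_le hR x

/-- The support of the ball cut-off lies in the closed ball of radius `√2 R`. [folklore] -/
theorem tsupport_sqBallCutoff_subset {R : ℝ} (hR : 0 < R) :
    tsupport (fun y : EuclideanSpace ℝ (Fin 3) => Real.smoothTransition (2 - ‖y‖ ^ 2 / R ^ 2) ^ 2) ⊆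
      closedBall (0 : EuclideanSpace ℝ (Fin 3)) (Real.sqrt 2 * R) := by
  refine closure_minimal (fun x hx => ?_) isClosed_closedBall
  rw [mem_closedBall, dist_zero_right]
  by_contra h
  push Not at h
  exact hx (sqBallCutoff_eq_zero_of_norm hR h.le)

/-- Points of the closed ball of radius `√2 R` lie in the cylinder box `{r ≤ 2R, |x₂| ≤ 2R}`.
[folklore] -/
theorem cylRadius_le_and_abs_le_of_mem_closedBall {R : ℝ} (hR : 0 < R) {x : EuclideanSpace ℝ (Fin 3)}
    (hx : x ∈ closedBall (0 : EuclideanSpace ℝ (Fin 3)) (Real.sqrt 2 * R)) :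
    cylRadius x ≤ 2 * R ∧ |x 2| ≤ 2 * R := by
  have hs : Real.sqrt 2 ≤ 2 := by
    rw [show (2 : ℝ) = Real.sqrt 4 by rw [show (4 : ℝ) = 2 ^ 2 by norm_num, Real.sqrt_sq (by norm_num)]]
    exact Real.sqrt_le_sqrt (by norm_num)
  have h2R : Real.sqrt 2 * R ≤ 2 * R := mul_le_mul_of_nonneg_right hs hR.le
  have h := closedBall_subset_solidCylinder (Real.sqrt 2 * R) hx
  exact ⟨h.1.trans h2R, h.2.trans h2R⟩

/-- On the axial segment `|z| ≤ R` the ball cut-off equals `1` at the meridian point `(0, 0, z)`.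
[folklore] -/
theorem sqBallCutoff_meridianPoint_axis_eq_one {R z : ℝ} (hR : 0 < R) (hz : |z| ≤ R) :
    Real.smoothTransition (2 - ‖meridianPoint (0, z)‖ ^ 2 / R ^ 2) ^ 2 = 1 := by
  refine sqBallCutoff_eq_one hR ?_
  have : ‖meridianPoint ((0 : ℝ), z)‖ = |z| := by
    rw [EuclideanSpace.norm_eq, Fin.sum_univ_three]
    simp [meridianPoint, Real.sqrt_sq_eq_abs]
  rw [this]; exact hz

/-- Off the closed ball of radius `√2 R` the ball cut-off, its gradient and its Laplacian vanish.
[folklore] -/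
theorem sqBallCutoff_derivs_eq_zero {R : ℝ} (hR : 0 < R) {x : EuclideanSpace ℝ (Fin 3)}
    (hx : x ∉ closedBall (0 : EuclideanSpace ℝ (Fin 3)) (Real.sqrt 2 * R)) :
    Real.smoothTransition (2 - ‖x‖ ^ 2 / R ^ 2) ^ 2 = 0 ∧
    fderiv ℝ (fun y : EuclideanSpace ℝ (Fin 3) => Real.smoothTransition (2 - ‖y‖ ^ 2 / R ^ 2) ^ 2) x = 0 ∧
    Δ (fun y : EuclideanSpace ℝ (Fin 3) => Real.smoothTransition (2 - ‖y‖ ^ 2 / R ^ 2) ^ 2) x = 0 := by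
  have h : x ∉ tsupport (fun y : EuclideanSpace ℝ (Fin 3) => Real.smoothTransition (2 - ‖y‖ ^ 2 / R ^ 2) ^ 2) :=
    fun h' => hx (tsupport_sqBallCutoff_subset hR h')
  refine ⟨?_, fderiv_of_notMem_tsupport ℝ h, laplacian_eq_zero_of_notMem_tsupport h⟩
  exact image_eq_zero_of_notMem_tsupport (f := fun y : EuclideanSpace ℝ (Fin 3) =>
    Real.smoothTransition (2 - ‖y‖ ^ 2 / R ^ 2) ^ 2) h

end BallCutoff

/-! ### The weight `Ψ = χ_R · w_{r₀}`: product rules and the pointwise bound of the junk terms -/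

section ProductWeight

/-- The horizontal part `(x₀, x₁, 0)` of `x` has norm `r`. [folklore] -/
theorem norm_horizontal_eq_cylRadius (x : EuclideanSpace ℝ (Fin 3)) :
    ‖(toLp 2 ![x 0, x 1, 0] : EuclideanSpace ℝ (Fin 3))‖ = cylRadius x := by
  rw [cylRadius, EuclideanSpace.norm_eq, Fin.sum_univ_three]
  simp [Real.norm_eq_abs, sq_abs]

/-- **The cross term of the Leibniz rule against the radial weight**: for any `C¹` function `Θ`,
`Σᵢ ∂ᵢΘ ∂ᵢw = −(2r₀²/(r₀² + r²)²) DΘ(x)[(x₀, x₁, 0)]` (the gradient of `w` is horizontal and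
radial). [folklore] -/
theorem sum_fderiv_mul_fderiv_radialWeight {r₀ : ℝ} (hr₀ : 0 < r₀) (Θ : EuclideanSpace ℝ (Fin 3) → ℝ)
    (x : EuclideanSpace ℝ (Fin 3)) :
    ∑ i, fderiv ℝ Θ x ((EuclideanSpace.basisFun (Fin 3) ℝ) i) *
        fderiv ℝ (fun y : EuclideanSpace ℝ (Fin 3) => r₀ ^ 2 / (r₀ ^ 2 + (y 0 ^ 2 + y 1 ^ 2))) x
          ((EuclideanSpace.basisFun (Fin 3) ℝ) i) =
      -(2 * r₀ ^ 2 / (r₀ ^ 2 + (x 0 ^ 2 + x 1 ^ 2)) ^ 2) *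
        fderiv ℝ Θ x (toLp 2 ![x 0, x 1, 0] : EuclideanSpace ℝ (Fin 3)) := by
  have hvec : (toLp 2 ![x 0, x 1, 0] : EuclideanSpace ℝ (Fin 3)) =
      (x 0) • EuclideanSpace.single 0 (1 : ℝ) + (x 1) • EuclideanSpace.single 1 (1 : ℝ) := by
    ext i; fin_cases i <;> simp
  rw [hvec, map_add, map_smul, map_smul, Fin.sum_univ_three]
  simp only [EuclideanSpace.basisFun_apply, fderiv_radialWeight_apply hr₀, smul_eq_mul]
  simp
  ring

/-- **The weight `Ψ = χ_R w_{r₀}` is smooth, compactly supported, axisymmetric and takes values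
in `[0, 1]`.** [folklore] -/
theorem productWeight_props {r₀ R : ℝ} (hr₀ : 0 < r₀) (hR : 0 < R) :
    ContDiff ℝ 2 (fun y : EuclideanSpace ℝ (Fin 3) =>
      Real.smoothTransition (2 - ‖y‖ ^ 2 / R ^ 2) ^ 2 * (r₀ ^ 2 / (r₀ ^ 2 + (y 0 ^ 2 + y 1 ^ 2)))) ∧
    HasCompactSupport (fun y : EuclideanSpace ℝ (Fin 3) =>
      Real.smoothTransition (2 - ‖y‖ ^ 2 / R ^ 2) ^ 2 * (r₀ ^ 2 / (r₀ ^ 2 + (y 0 ^ 2 + y 1 ^ 2)))) ∧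
    IsAxisymmetricScalar (fun y : EuclideanSpace ℝ (Fin 3) =>
      Real.smoothTransition (2 - ‖y‖ ^ 2 / R ^ 2) ^ 2 * (r₀ ^ 2 / (r₀ ^ 2 + (y 0 ^ 2 + y 1 ^ 2)))) ∧
    (∀ y : EuclideanSpace ℝ (Fin 3),
      0 ≤ Real.smoothTransition (2 - ‖y‖ ^ 2 / R ^ 2) ^ 2 * (r₀ ^ 2 / (r₀ ^ 2 + (y 0 ^ 2 + y 1 ^ 2))) ∧
      Real.smoothTransition (2 - ‖y‖ ^ 2 / R ^ 2) ^ 2 * (r₀ ^ 2 / (r₀ ^ 2 + (y 0 ^ 2 + y 1 ^ 2))) ≤ 1) := by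
  refine ⟨(contDiff_sqBallCutoff R).mul (contDiff_radialWeight hr₀), ?_, ?_, fun y => ?_⟩
  · exact (hasCompactSupport_sqBallCutoff hR).mul_right
  · intro θ y
    simp only [isAxisymmetricScalar_sqBallCutoff R θ y, isAxisymmetricScalar_radialWeight r₀ θ y]
  · obtain ⟨hw0, hw1⟩ := radialWeight_pos_le_one hr₀ y
    have h0 := sqBallCutoff_nonneg R y
    have h1 := sqBallCutoff_le_one R y
    exact ⟨mul_nonneg h0 hw0.le, by nlinarith⟩

/-- On the axis the weight `Ψ = χ_R w_{r₀}` is the ball cut-off (the radial weight is `1`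
there); in particular `Ψ(0, 0, z) = 1` for `|z| ≤ R`. [folklore] -/
theorem productWeight_meridianPoint_axis {r₀ R : ℝ} (hr₀ : 0 < r₀) (z : ℝ) :
    Real.smoothTransition (2 - ‖meridianPoint (0, z)‖ ^ 2 / R ^ 2) ^ 2 *
        (r₀ ^ 2 / (r₀ ^ 2 + ((meridianPoint (0, z)) 0 ^ 2 + (meridianPoint (0, z)) 1 ^ 2))) =
      Real.smoothTransition (2 - ‖meridianPoint (0, z)‖ ^ 2 / R ^ 2) ^ 2 := by
  rw [radialWeight_eq_one_of_cylRadius_eq_zero hr₀ (by rw [cylRadius_meridianPoint_eq_abs, abs_zero]), mul_one]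

variable {r₀ R B₁ B₂ Cb M : ℝ}

/-- **The pointwise bound of the junk terms of the energy identity** (Lei–Ren–Zhang 2019, §4,
Steps 3–4: every term of (4.5), (4.9) in which a derivative falls on the cut-off or on the weight
`λ`). For the weight `Ψ = χ_R w_{r₀}`, a vector `v` with `‖v‖ ≤ C_b` and radial component
`|⟪v, e_r⟫| ≤ M`, and at every point,
`|ΔΨ + DΨ[v] + (2/r) DΨ[e_r]| ≤ h(r)` with
`h(ρ) = 8r₀²/D² + (B₂/R² + B₁C_b/R) r₀²/D + (4r₀²B₁/R + 2r₀²M) ρ/D² + (2B₁/R)(r₀²/D)/ρ`,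
`D = r₀² + ρ²`, where `B₁/R`, `B₂/R²` bound `‖Dχ_R‖`, `|Δχ_R|`. [cite: LeiRenZhang2019, §4 Steps 3–4, (4.5)–(4.11) (arXiv pp. 10–11)] -/
theorem abs_junk_productWeight_le (hr₀ : 0 < r₀) (hR : 0 < R) (hB₁ : 0 ≤ B₁)
    (hDΘ : ∀ x : EuclideanSpace ℝ (Fin 3),
      ‖fderiv ℝ (fun y : EuclideanSpace ℝ (Fin 3) => Real.smoothTransition (2 - ‖y‖ ^ 2 / R ^ 2) ^ 2) x‖ ≤ B₁ / R)
    (hΔΘ : ∀ x : EuclideanSpace ℝ (Fin 3),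
      |Δ (fun y : EuclideanSpace ℝ (Fin 3) => Real.smoothTransition (2 - ‖y‖ ^ 2 / R ^ 2) ^ 2) x| ≤ B₂ / R ^ 2)
    (x v : EuclideanSpace ℝ (Fin 3)) (hv : ‖v‖ ≤ Cb) (hvr : |⟪v, eR x⟫| ≤ M) :
    |Δ (fun y : EuclideanSpace ℝ (Fin 3) =>
          Real.smoothTransition (2 - ‖y‖ ^ 2 / R ^ 2) ^ 2 * (r₀ ^ 2 / (r₀ ^ 2 + (y 0 ^ 2 + y 1 ^ 2)))) x
      + fderiv ℝ (fun y : EuclideanSpace ℝ (Fin 3) =>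
          Real.smoothTransition (2 - ‖y‖ ^ 2 / R ^ 2) ^ 2 * (r₀ ^ 2 / (r₀ ^ 2 + (y 0 ^ 2 + y 1 ^ 2)))) x v
      + 2 / cylRadius x * fderiv ℝ (fun y : EuclideanSpace ℝ (Fin 3) =>
          Real.smoothTransition (2 - ‖y‖ ^ 2 / R ^ 2) ^ 2 * (r₀ ^ 2 / (r₀ ^ 2 + (y 0 ^ 2 + y 1 ^ 2)))) x (eR x)| ≤
      8 * r₀ ^ 2 / (r₀ ^ 2 + cylRadius x ^ 2) ^ 2
      + (B₂ / R ^ 2 + B₁ * Cb / R) * (r₀ ^ 2 / (r₀ ^ 2 + cylRadius x ^ 2))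
      + (4 * r₀ ^ 2 * B₁ / R + 2 * r₀ ^ 2 * M) * cylRadius x / (r₀ ^ 2 + cylRadius x ^ 2) ^ 2
      + 2 * B₁ / R * (r₀ ^ 2 / (r₀ ^ 2 + cylRadius x ^ 2)) / cylRadius x := by
  -- names
  set Θ : EuclideanSpace ℝ (Fin 3) → ℝ := fun y => Real.smoothTransition (2 - ‖y‖ ^ 2 / R ^ 2) ^ 2 with hΘ
  set w : EuclideanSpace ℝ (Fin 3) → ℝ := fun y => r₀ ^ 2 / (r₀ ^ 2 + (y 0 ^ 2 + y 1 ^ 2)) with hw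
  set r : ℝ := cylRadius x with hr
  set D : ℝ := r₀ ^ 2 + r ^ 2 with hDdef
  have hr0 : 0 ≤ r := cylRadius_nonneg x
  have hD : 0 < D := by positivity
  have hΘ2 : ContDiff ℝ 2 Θ := contDiff_sqBallCutoff R
  have hw2 : ContDiff ℝ 2 w := contDiff_radialWeight hr₀
  have hΘd : DifferentiableAt ℝ Θ x := (hΘ2.differentiable (by norm_num)) x
  have hwd : DifferentiableAt ℝ w x := (hw2.differentiable (by norm_num)) x
  have hΘ01 : 0 ≤ Θ x ∧ Θ x ≤ 1 := ⟨sqBallCutoff_nonneg R x, sqBallCutoff_le_one R x⟩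
  have hwx : w x = r₀ ^ 2 / D := by simp only [hw, hDdef, hr, radialWeight_eq_profile]
  have hw01 : 0 ≤ w x ∧ w x ≤ 1 := ⟨(radialWeight_pos_le_one hr₀ x).1.le, (radialWeight_pos_le_one hr₀ x).2⟩
  have hden : r₀ ^ 2 + (x 0 ^ 2 + x 1 ^ 2) = D := by rw [hDdef, hr, radialWeight_den_eq]
  -- the three product rules
  have hprod : (fun y => Θ y * w y) = fun y => Θ y * w y := rfl
  have hD1 : ∀ u : EuclideanSpace ℝ (Fin 3), fderiv ℝ (fun y => Θ y * w y) x u = Θ x * fderiv ℝ w x u + w x * fderiv ℝ Θ x u := by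
    intro u
    have h : HasFDerivAt (fun y => Θ y * w y) (Θ x • fderiv ℝ w x + w x • fderiv ℝ Θ x) x :=
      hΘd.hasFDerivAt.mul hwd.hasFDerivAt
    rw [h.fderiv]
    rfl
  have hΔ : Δ (fun y => Θ y * w y) x = Θ x * (Δ w) x + w x * (Δ Θ) x +
      2 * (-(2 * r₀ ^ 2 / D ^ 2) * fderiv ℝ Θ x (toLp 2 ![x 0, x 1, 0] : EuclideanSpace ℝ (Fin 3))) := by
    rw [laplacian_mul_eq (EuclideanSpace.basisFun (Fin 3) ℝ) hΘ2 hw2 x, sum_fderiv_mul_fderiv_radialWeight hr₀ Θ x, hden]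
  -- sizes of the ingredients
  have hDw : ∀ u : EuclideanSpace ℝ (Fin 3), |fderiv ℝ w x u| = 2 * r₀ ^ 2 * r / D ^ 2 * |⟪eR x, u⟫| := fun u => by
    rw [hw, abs_fderiv_radialWeight_apply_eq hr₀]
  have hΔw : |(Δ w) x| ≤ 4 * r₀ ^ 2 / D ^ 2 := abs_laplacian_radialWeight_le hr₀ x
  have hDΘu : ∀ u : EuclideanSpace ℝ (Fin 3), |fderiv ℝ Θ x u| ≤ B₁ / R * ‖u‖ := fun u => by
    rw [← Real.norm_eq_abs]
    exact ((fderiv ℝ Θ x).le_opNorm u).trans (mul_le_mul_of_nonneg_right (hDΘ x) (norm_nonneg _))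
  have heRn : ‖eR x‖ ≤ 1 := norm_eR_le_one x
  have hhor : ‖(toLp 2 ![x 0, x 1, 0] : EuclideanSpace ℝ (Fin 3))‖ = r := norm_horizontal_eq_cylRadius x
  -- (a) the Laplacian term
  have ha : |Δ (fun y => Θ y * w y) x| ≤ 4 * r₀ ^ 2 / D ^ 2 + (r₀ ^ 2 / D) * (B₂ / R ^ 2) +
      4 * r₀ ^ 2 * r / D ^ 2 * (B₁ / R) := by
    rw [hΔ]
    refine (abs_add_le _ _).trans (add_le_add ((abs_add_le _ _).trans (add_le_add ?_ ?_)) ?_)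
    · rw [abs_mul, abs_of_nonneg hΘ01.1]
      exact (mul_le_mul hΘ01.2 hΔw (abs_nonneg _) zero_le_one).trans (by rw [one_mul])
    · rw [abs_mul, abs_of_nonneg hw01.1, hwx]
      exact mul_le_mul_of_nonneg_left (hΔΘ x) (by positivity)
    · rw [abs_mul, abs_two, abs_mul, abs_neg, abs_of_nonneg (by positivity : (0:ℝ) ≤ 2 * r₀ ^ 2 / D ^ 2)]
      have h1 := (hDΘu _).trans_eq (by rw [hhor] : B₁ / R * ‖(toLp 2 ![x 0, x 1, 0] : EuclideanSpace ℝ (Fin 3))‖ = B₁ / R * r)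
      have h2 : 2 * (2 * r₀ ^ 2 / D ^ 2 * |fderiv ℝ Θ x (toLp 2 ![x 0, x 1, 0])|) ≤
          2 * (2 * r₀ ^ 2 / D ^ 2 * (B₁ / R * r)) := by gcongr
      refine h2.trans_eq ?_
      ring
  -- (b) the transport term
  have hb : |fderiv ℝ (fun y => Θ y * w y) x v| ≤ 2 * r₀ ^ 2 * r / D ^ 2 * M + (r₀ ^ 2 / D) * (B₁ / R * Cb) := by
    rw [hD1]
    refine (abs_add_le _ _).trans (add_le_add ?_ ?_)
    · rw [abs_mul, abs_of_nonneg hΘ01.1, hDw]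
      have hvr' : |⟪eR x, v⟫| ≤ M := by rwa [real_inner_comm]
      calc Θ x * (2 * r₀ ^ 2 * r / D ^ 2 * |⟪eR x, v⟫|) ≤ 1 * (2 * r₀ ^ 2 * r / D ^ 2 * M) :=
            mul_le_mul hΘ01.2 (mul_le_mul_of_nonneg_left hvr' (by positivity)) (by positivity) zero_le_one
        _ = 2 * r₀ ^ 2 * r / D ^ 2 * M := one_mul _
    · rw [abs_mul, abs_of_nonneg hw01.1, hwx]
      exact mul_le_mul_of_nonneg_left ((hDΘu v).trans (mul_le_mul_of_nonneg_left hv (by positivity))) (by positivity)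
  -- (c) the axis term
  have hc : |2 / cylRadius x * fderiv ℝ (fun y => Θ y * w y) x (eR x)| ≤
      4 * r₀ ^ 2 / D ^ 2 + 2 * (B₁ / R) * (r₀ ^ 2 / D) / r := by
    rw [hD1, mul_add, ← hr]
    refine (abs_add_le _ _).trans (add_le_add ?_ ?_)
    · by_cases hrz : r = 0
      · rw [hrz, div_zero, zero_mul, abs_zero]; positivity
      · have hrpos : 0 < r := lt_of_le_of_ne hr0 (Ne.symm hrz)
        rw [abs_mul, abs_mul, abs_of_nonneg hΘ01.1, hDw, inner_eR_self (by rw [← hr]; exact hrz), abs_one, mul_one,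
          abs_div, abs_two, abs_of_pos hrpos]
        calc 2 / r * (Θ x * (2 * r₀ ^ 2 * r / D ^ 2)) ≤ 2 / r * (1 * (2 * r₀ ^ 2 * r / D ^ 2)) := by
              gcongr; exact hΘ01.2
          _ = 4 * r₀ ^ 2 / D ^ 2 := by field_simp; ring
    · by_cases hrz : r = 0
      · rw [hrz, div_zero, zero_mul, abs_zero, div_zero]
      · have hrpos : 0 < r := lt_of_le_of_ne hr0 (Ne.symm hrz)
        rw [abs_mul, abs_mul, abs_of_nonneg hw01.1, hwx, abs_div, abs_two, abs_of_pos hrpos]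
        have h1 : |fderiv ℝ Θ x (eR x)| ≤ B₁ / R := (hDΘu _).trans (mul_le_of_le_one_right (by positivity) heRn)
        calc 2 / r * (r₀ ^ 2 / D * |fderiv ℝ Θ x (eR x)|) ≤ 2 / r * (r₀ ^ 2 / D * (B₁ / R)) := by gcongr
          _ = 2 * (B₁ / R) * (r₀ ^ 2 / D) / r := by field_simp
  -- assemble
  have htot := (abs_add_le _ _).trans (add_le_add ((abs_add_le _ _).trans (add_le_add ha hb)) hc)
  refine htot.trans (le_of_eq ?_)
  simp only [hDdef]
  field_simp
  ring

end ProductWeight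

/-! ### The axis integral `∫ (2/r) ∂ᵣΨ dx = −2c₂ ∫ Ψ(0,0,z) dz` -/

section AxisIntegral

/-- **The source on the axis.** For an axisymmetric `C¹` function `Ψ` with compact support,
`x ↦ (2/r) DΨ(x)[e_r]` is integrable and `∫ (2/r) ∂ᵣΨ dx = −2 c₂ ∫ Ψ(0, 0, z) dz`
(radial reduction `dx = r dr dθ dz` and `∫₀^∞ 2 ∂_ρ Ψ(ρ, 0, z) dρ = −2 Ψ(0, 0, z)`): the field
`(1/r) e_r` is divergence free off the axis and carries the flux `c₂ = 2π` out of it. This is the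
term that makes the energy method work: "exploiting … the fact that `Γ = 0` at the `z` axis"
(Lei–Ren–Zhang 2019, §1 p. 4 and §4, the term `T₂` of (4.7), which produces `−RT/6`). [cite: LeiRenZhang2019, §4 (4.7) (arXiv p. 11)] -/
theorem integral_two_div_cylRadius_mul_fderiv_eR_eq {Ψ : EuclideanSpace ℝ (Fin 3) → ℝ}
    (hΨ : ContDiff ℝ 1 Ψ) (hΨc : HasCompactSupport Ψ) (hΨa : IsAxisymmetricScalar Ψ) :
    Integrable (fun x => 2 / cylRadius x * fderiv ℝ Ψ x (eR x)) ∧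
    Integrable (fun z : ℝ => Ψ (meridianPoint (0, z))) ∧
    ∫ x, 2 / cylRadius x * fderiv ℝ Ψ x (eR x) = -(2 * radialConst₂) * ∫ z : ℝ, Ψ (meridianPoint (0, z)) := by
  have hΨd : Differentiable ℝ Ψ := hΨ.differentiable one_ne_zero
  -- a cylinder box containing the support
  obtain ⟨R, hR⟩ : ∃ R : ℝ, tsupport Ψ ⊆ closedBall (0 : EuclideanSpace ℝ (Fin 3)) R :=
    (hΨc.isCompact.isBounded).subset_closedBall 0
  have hK : tsupport Ψ ⊆ solidCylinder R R := hR.trans (closedBall_subset_solidCylinder R)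
  have hsupp : ∀ x, x ∉ tsupport Ψ → Ψ x = 0 ∧ fderiv ℝ Ψ x = 0 := fun x hx =>
    ⟨image_eq_zero_of_notMem_tsupport hx, fderiv_of_notMem_tsupport ℝ hx⟩
  -- bounds
  obtain ⟨CD, hCD0, hCD⟩ : ∃ C, 0 ≤ C ∧ ∀ x, ‖fderiv ℝ Ψ x‖ ≤ C := by
    obtain ⟨C, hC⟩ := (hΨ.continuous_fderiv one_ne_zero).bounded_above_of_compact_support (hΨc.fderiv (𝕜 := ℝ))
    exact ⟨|C|, abs_nonneg C, fun x => (hC x).trans (le_abs_self C)⟩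
  have hDle : ∀ x, |fderiv ℝ Ψ x (eR x)| ≤ CD := fun x => by
    rw [← Real.norm_eq_abs]
    exact ((fderiv ℝ Ψ x).le_opNorm _).trans ((mul_le_of_le_one_right (norm_nonneg _) (norm_eR_le_one _)).trans (hCD x))
  -- the integrand
  set G : EuclideanSpace ℝ (Fin 3) → ℝ := fun x => 2 / cylRadius x * fderiv ℝ Ψ x (eR x) with hG
  have happly : Measurable fun p : (EuclideanSpace ℝ (Fin 3) →L[ℝ] ℝ) × EuclideanSpace ℝ (Fin 3) => p.1 p.2 :=
    (isBoundedBilinearMap_apply (𝕜 := ℝ) (E := EuclideanSpace ℝ (Fin 3)) (F := ℝ)).continuous.measurable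
  have hmD : Measurable fun x => fderiv ℝ Ψ x (eR x) :=
    happly.comp ((hΨ.continuous_fderiv one_ne_zero).measurable.prodMk measurable_eR)
  have hmG : AEStronglyMeasurable G volume :=
    ((measurable_const.div continuous_cylRadius.measurable).mul hmD).aestronglyMeasurable
  have hdom := ((integrableOn_inv_cylRadius_solidCylinder R R).integrable_indicator
    (measurableSet_solidCylinder R R)).const_mul (2 * CD)
  have hGint : Integrable G := by
    refine hdom.mono' hmG (Eventually.of_forall fun x => ?_)
    rw [Real.norm_eq_abs]
    by_cases hx : x ∈ tsupport Ψ
    · rw [indicator_of_mem (hK hx), hG]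
      simp only []
      rw [abs_mul, abs_div, abs_two, abs_of_nonneg (cylRadius_nonneg x), div_eq_mul_inv]
      have hr : 0 ≤ (cylRadius x)⁻¹ := inv_nonneg.2 (cylRadius_nonneg x)
      nlinarith [hDle x, abs_nonneg (fderiv ℝ Ψ x (eR x))]
    · have : G x = 0 := by simp [hG, (hsupp x hx).2]
      rw [this, abs_zero]
      exact mul_nonneg (by positivity) (indicator_nonneg (fun y _ => inv_nonneg.2 (cylRadius_nonneg y)) _)
  -- the axial profile is continuous with compact support
  have hc0 : Continuous fun z : ℝ => meridianPoint ((0 : ℝ), z) :=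
    (contDiff_meridianPoint (n := 0)).continuous.comp (continuous_const.prodMk continuous_id)
  have hprof_c : Continuous fun z : ℝ => Ψ (meridianPoint (0, z)) := hΨ.continuous.comp hc0
  have hprof_supp : HasCompactSupport fun z : ℝ => Ψ (meridianPoint (0, z)) := by
    refine HasCompactSupport.intro (isCompact_Icc (a := -R) (b := R)) fun z hz => ?_
    apply (hsupp _ _).1
    intro hmem
    have h1 := hK hmem
    simp only [solidCylinder, mem_setOf_eq, meridianPoint_apply_two] at h1
    simp only [mem_Icc, not_and_or, not_le, abs_le] at hz h1
    rcases hz with hz | hz <;> linarith [h1.2.1, h1.2.2]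
  have hprof_int : Integrable fun z : ℝ => Ψ (meridianPoint (0, z)) := hprof_c.integrable_of_hasCompactSupport hprof_supp
  refine ⟨hGint, hprof_int, ?_⟩
  -- radial reduction
  have hGa : IsAxisymmetricScalar G := by
    have h1 := hΨa.fderiv_apply_eR hΨd
    intro θ x
    simp only [hG, cylRadius_rotZ, h1 θ x]
  rw [hGa.integral_eq hGint]
  have hslice : ∀ z : ℝ, (∫ ρ in Ioi (0 : ℝ), ρ • G (meridianPoint (ρ, z))) = -2 * Ψ (meridianPoint (0, z)) := by
    intro z
    set P : ℝ → ℝ := fun ρ => Ψ (meridianPoint (ρ, z)) with hP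
    set P' : ℝ → ℝ := fun ρ => fderiv ℝ Ψ (meridianPoint (ρ, z)) (EuclideanSpace.single 0 1) with hP'
    have hPd : ∀ ρ, HasDerivAt P (P' ρ) ρ := fun ρ => hasDerivAt_comp_meridianPoint_fst z (hΨd _)
    have heq : EqOn (fun ρ => ρ • G (meridianPoint (ρ, z))) (fun ρ => 2 * P' ρ) (Ioi 0) := by
      intro ρ hρ
      have hρ' : (0 : ℝ) < ρ := hρ
      simp only [hG, hP', smul_eq_mul, cylRadius_meridianPoint_eq_abs, abs_of_pos hρ', eR_meridianPoint hρ']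
      field_simp
    rw [setIntegral_congr_fun measurableSet_Ioi heq, integral_const_mul]
    have hout : ∀ ρ, R < |ρ| → meridianPoint (ρ, z) ∉ tsupport Ψ := by
      intro ρ hρ hmem
      have h1 := hK hmem
      simp only [solidCylinder, mem_setOf_eq, cylRadius_meridianPoint_eq_abs] at h1
      linarith [h1.1]
    have hP'zero : ∀ ρ, R < |ρ| → P' ρ = 0 := fun ρ hρ => by
      simp [hP', (hsupp _ (hout ρ hρ)).2]
    have hc : Continuous fun ρ : ℝ => meridianPoint (ρ, z) :=
      continuous_iff_continuousAt.2 fun ρ => (hasDerivAt_meridianPoint_fst ρ z).continuousAt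
    have hP'c : Continuous P' := ((hΨ.continuous_fderiv one_ne_zero).comp hc).clm_apply continuous_const
    have hP'int : IntegrableOn P' (Ioi 0) := by
      refine (Continuous.integrable_of_hasCompactSupport hP'c ?_).integrableOn
      refine HasCompactSupport.intro (isCompact_Icc (a := -(R + 1)) (b := R + 1)) fun ρ hρ => ?_
      apply hP'zero
      simp only [mem_Icc, not_and_or, not_le] at hρ
      rcases hρ with hρ | hρ
      · linarith [neg_le_abs ρ]
      · linarith [le_abs_self ρ]
    have hPlim : Tendsto P atTop (𝓝 0) := by
      apply tendsto_const_nhds.congr'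
      filter_upwards [eventually_gt_atTop |R|] with ρ hρ
      have hρ' : R < |ρ| := (le_abs_self R).trans_lt (hρ.trans_le (le_abs_self ρ))
      simp only [hP, (hsupp _ (hout ρ hρ')).1]
    rw [integral_Ioi_of_hasDerivAt_of_tendsto' (fun ρ _ => hPd ρ) hP'int hPlim]
    simp only [hP]
    ring
  simp_rw [hslice, smul_eq_mul]
  rw [integral_const_mul, integral_const_mul]
  ring

/-- **The axial plateau of the ball cut-off**: `2R ≤ ∫ χ_R(0, 0, z) dz` (`χ_R ≥ 0` and `χ_R = 1` on
`|z| ≤ R`). [folklore] -/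
theorem two_mul_le_integral_sqBallCutoff_axis {R : ℝ} (hR : 0 < R)
    (hint : Integrable fun z : ℝ => Real.smoothTransition (2 - ‖meridianPoint (0, z)‖ ^ 2 / R ^ 2) ^ 2) :
    2 * R ≤ ∫ z : ℝ, Real.smoothTransition (2 - ‖meridianPoint (0, z)‖ ^ 2 / R ^ 2) ^ 2 := by
  have h1 : ∫ z in Icc (-R) R, (1 : ℝ) = 2 * R := by
    rw [setIntegral_const, Real.volume_real_Icc_of_le (by linarith), smul_eq_mul, mul_one]; ring
  rw [← h1]
  calc ∫ z in Icc (-R) R, (1 : ℝ) = ∫ z in Icc (-R) R, Real.smoothTransition (2 - ‖meridianPoint (0, z)‖ ^ 2 / R ^ 2) ^ 2 := by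
        refine setIntegral_congr_fun measurableSet_Icc fun z hz => ?_
        exact (sqBallCutoff_meridianPoint_axis_eq_one hR (abs_le.2 ⟨by linarith [hz.1], hz.2⟩)).symm
    _ ≤ ∫ z, Real.smoothTransition (2 - ‖meridianPoint (0, z)‖ ^ 2 / R ^ 2) ^ 2 :=
        setIntegral_le_integral hint (Eventually.of_forall fun z => sqBallCutoff_nonneg R _)

end AxisIntegral

end Literature.Analysis.FluidPDE

end
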